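import Summits.QuantumFields.YangMills.Theorems.FluctuationComparisonRegPrIntLS2BetaEPrimeComb

/-!
# The weighted local-perturbation engine: a Kotecký–Preiss volume from cell-dependent bounds (E′)

Helper file for crux `Summit.QuantumFields.YangMills.Theses.UnitScaleTilt.FluctuationComparisonRegPrIntL`
(item stmt-QuantumFields-20520), `--supports`, hypothesis form, **definition-free**.  It proves, token
for token, the `Prop` `WeightedLocalPerturbationKP` typed by the ideator (ym-r3-idea-1 g19) in
`Cruxes/FluctuationComparisonRegPrIntL/EPrimeSketch.lean` — item E′ of crux idea `neumann-frd-step`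
(card `Ideas/neumann-frd-step.md` v1.2): the WEIGHTED edition of the tree's engine
`Literature.Probability.LatticeModels.LocalPerturbation{PolymerGas,ClusterExpansion}`
(✓`isKPVolume_connActivity` asks a UNIFORM factor bound `ε` and degree `Δ`; from the second
finite-range sub-field of the Neumann decomposition on, the factors are indexed by POLYMERS of the
previous step, with weights `e^{-τ|X|}` and unbounded degree — whence cell-dependent weights and a
PINNED criterion, the format of ✓`…S2BetaKPLCriterion.kp_of_pinned_criterion`).

**Mathematics.**  `IsLocalPerturbation μ R 𝓕 g ε` (cell σ-algebras, independence of non-touching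
cell sets, `𝓕 p`-measurable factors) with CELL-DEPENDENT bounds `‖g v ω‖ ≤ w v` and the
DOUBLED-EXPONENT pinned criterion `∀ v ∈ C, ∑_{u ∈ C, u = v ∨ R u v} w u · e^{2 a u} ≤ a v`.  THEN the
connected activities `connActivity R μ g` form a KP volume (`IsKPVolume`) on the polymers
`rconnSubsets R C` for the geometric incompatibility `GeomInc R` with size function `K ↦ ∑_{v ∈ K} a v`
(`isKPVolume_connActivity_weighted`; by text `weightedLocalPerturbationKP`) — whence
`exp (log Z(C)) = Z(C)` (`exp_pertLogZ_weighted`, via ✓`exp_polymerLogZ_of_kp`), the unconditional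
cluster expansion ✓`pertLogZ_eq_sum_truncatedWeight`, and a `PolymerRepOn` via
✓`…S2BetaKPLogRep.polymerRep_of_kpGas`.

Proof: `‖connActivity K'‖ · e^{∑_{K'} a} ≤ ∏_{u ∈ K'} (w u · e^{a u})` (`norm_connActivity_le_prod`);
a polymer `K'` incompatible with `K` contains a cell `u` equal or adjacent to a cell `v ∈ K`
(`exists_mem_eq_or_rel_of_geomInc`); two applications of the covering lemma
(✓`…EPrimeComb.sum_le_sum_sum_filter_of_cover`) and E′-COMB (✓`…EPrimeComb.pinned_connected_sum_le`)
at weights `w · e^{a}` for the reflexive-symmetric cell incompatibility `u = v ∨ R u v`, whose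
connected sets are the `R`-connected ones (`isRConnected_eq_or_iff`).

Sources: [cite: KoteckyPreiss1986, §2]; [cite: FriedliVelenik2017, §5.4, §5.7.1];
[cite: BauerschmidtBrydgesSlade2019, §3.3 (finite-range property ⇒ factorisation)].

HONEST LABEL.  A generic probability/combinatorics lemma supplying NO estimate of the lane: not
GAS₁, not REP; it proves no stub; the crux idea's window-bookkeeping cost is untouched; nothing of
`FluctuationComparisonRegPrIntL` (20520) is proved here.  Rung R3 (YM₃ = SU(2) on T³) is NOT d = 4,
NOT infinite volume, NOT a mass gap, NOT the Clay problem.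
-/

namespace Summit.QuantumFields.YangMills.Theorems.FluctuationComparisonRegPrIntLS2BetaEPrimeWeightedKP

open Finset MeasureTheory Literature.Probability.LatticeModels
open Summit.QuantumFields.YangMills.Theorems.FluctuationComparisonRegPrIntLS2BetaEPrimeComb
open scoped BigOperators

variable {V : Type*} [DecidableEq V]

/-! ## §1 Connectivity for `R` and for its reflexive closure -/

omit [DecidableEq V] in
/-- The `R`-connected sets are exactly the `(= ∨ R)`-connected sets (reflexive steps are idle). -/
theorem isRConnected_eq_or_iff (R : V → V → Prop) (X : Finset V) :
    IsRConnected (fun x y => x = y ∨ R x y) X ↔ IsRConnected R X := by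
  constructor
  · rintro ⟨hne, hconn⟩
    refine ⟨hne, fun v hv w hw => ?_⟩
    have key : ∀ w, Relation.ReflTransGen (fun x y => (x = y ∨ R x y) ∧ x ∈ X ∧ y ∈ X) v w →
        Relation.ReflTransGen (fun x y => R x y ∧ x ∈ X ∧ y ∈ X) v w := by
      intro w h
      induction h with
      | refl => exact Relation.ReflTransGen.refl
      | @tail b c _ hbc ih =>
        obtain ⟨hbc', hbX, hcX⟩ := hbc
        rcases hbc' with rfl | hR
        · exact ih
        · exact ih.tail ⟨hR, hbX, hcX⟩
    exact key w (hconn v hv w hw)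
  · rintro ⟨hne, hconn⟩
    refine ⟨hne, fun v hv w hw => ?_⟩
    have key : ∀ w, Relation.ReflTransGen (fun x y => R x y ∧ x ∈ X ∧ y ∈ X) v w →
        Relation.ReflTransGen (fun x y => (x = y ∨ R x y) ∧ x ∈ X ∧ y ∈ X) v w := by
      intro w h
      induction h with
      | refl => exact Relation.ReflTransGen.refl
      | @tail b c _ hbc ih => exact ih.tail ⟨Or.inr hbc.1, hbc.2.1, hbc.2.2⟩
    exact key w (hconn v hv w hw)

omit [DecidableEq V] in
/-- Hence the polymer families agree: `rconnSubsets (= ∨ R) C = rconnSubsets R C`. -/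
theorem rconnSubsets_eq_or (R : V → V → Prop) (C : Finset V) :
    rconnSubsets (fun x y => x = y ∨ R x y) C = rconnSubsets R C := by
  ext X
  rw [mem_rconnSubsets, mem_rconnSubsets, isRConnected_eq_or_iff]

omit [DecidableEq V] in
/-- A polymer geometrically incompatible with a nonempty `K` contains a cell equal or adjacent to a
cell of `K`. -/
theorem exists_mem_eq_or_rel_of_geomInc {R : V → V → Prop} {K K' : Finset V} (hK : K.Nonempty)
    (h : GeomInc R K' K) : ∃ v ∈ K, ∃ u ∈ K', u = v ∨ R u v := by
  rcases h with rfl | ⟨u, hu, v, hv, huv⟩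
  · obtain ⟨v, hv⟩ := hK
    exact ⟨v, hv, v, hv, Or.inl rfl⟩
  · exact ⟨v, hv, u, hu, huv⟩

/-! ## §2 The weighted activity bound -/

variable {Ω : Type*} [MeasurableSpace Ω] {μ : Measure Ω} {R : V → V → Prop}
  {𝓕 : V → MeasurableSpace Ω} {g : V → Ω → ℂ} {ε : ℝ} {w a : V → ℝ}

omit [DecidableEq V] in
/-- Weighted twin of ✓`norm_cellActivity_le`: `‖M(K)‖ ≤ ∏_{u ∈ K} w u` when `‖g u ω‖ ≤ w u`. -/
theorem norm_cellActivity_le_prod [IsProbabilityMeasure μ] (hgw : ∀ v ω, ‖g v ω‖ ≤ w v)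
    (K : Finset V) : ‖cellActivity μ g K‖ ≤ ∏ u ∈ K, w u := by
  have hpt : ∀ ω, ‖∏ p ∈ K, g p ω‖ ≤ ∏ u ∈ K, w u := by
    intro ω
    rw [norm_prod]
    exact prod_le_prod (fun p _ => norm_nonneg _) fun p _ => hgw p ω
  have := norm_integral_le_of_norm_le_const (μ := μ) (f := fun ω => ∏ p ∈ K, g p ω)
    (C := ∏ u ∈ K, w u) (Filter.Eventually.of_forall hpt)
  rwa [probReal_univ, mul_one] at this

omit [DecidableEq V] in
/-- The KP term of a connected activity is at most the product of the weights `w u · e^{a u}`: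
`‖connActivity K'‖ · exp (∑_{u ∈ K'} a u) ≤ ∏_{u ∈ K'} (w u · e^{a u})`. -/
theorem kpTerm_connActivity_le [IsProbabilityMeasure μ] (hgw : ∀ v ω, ‖g v ω‖ ≤ w v)
    (hw : ∀ v, 0 ≤ w v) (K' : Finset V) :
    kpTerm (connActivity R μ g) (fun K => ∑ v ∈ K, a v) K' ≤ ∏ u ∈ K', (w u * Real.exp (a u)) := by
  have hnorm : ‖connActivity R μ g K'‖ ≤ ∏ u ∈ K', w u := by
    simp only [connActivity]
    split_ifs
    · exact norm_cellActivity_le_prod hgw K'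
    · rw [norm_zero]; exact prod_nonneg fun u _ => hw u
  simp only [kpTerm]
  rw [Real.exp_sum, prod_mul_distrib]
  exact mul_le_mul_of_nonneg_right hnorm (prod_nonneg fun u _ => Real.exp_nonneg _)

/-! ## §3 The weighted KP volume -/

/-- **THE WEIGHTED LOCAL-PERTURBATION ENGINE (KP VOLUME).**  Under `IsLocalPerturbation μ R 𝓕 g ε`,
cell-dependent bounds `‖g v ω‖ ≤ w v` and the doubled-exponent pinned criterion
`∀ v ∈ C, ∑_{u ∈ C, u = v ∨ R u v} w u · e^{2 a u} ≤ a v` (`R` symmetric), the connected activities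
form a Kotecký–Preiss volume on `rconnSubsets R C` for `GeomInc R` with size `K ↦ ∑_{v ∈ K} a v`.
[cite: KoteckyPreiss1986, §2] [cite: FriedliVelenik2017, §5.7.1] -/
theorem isKPVolume_connActivity_weighted [IsProbabilityMeasure μ] [DecidableRel R]
    (hR : ∀ x y, R x y → R y x) (hgw : ∀ v ω, ‖g v ω‖ ≤ w v) (C : Finset V)
    (hcrit : ∀ v ∈ C, ∑ u ∈ C with (u = v ∨ R u v), w u * Real.exp (2 * a u) ≤ a v) :
    IsKPVolume (GeomInc R) (connActivity R μ g) (fun K => ∑ v ∈ K, a v) (rconnSubsets R C) := by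
  classical
  -- `Ω` is nonempty, so the weights are non-negative
  have hΩ : Nonempty Ω := by
    by_contra h
    rw [not_nonempty_iff] at h
    have h1 := measure_univ (μ := μ)
    rw [Set.univ_eq_empty_iff.mpr h, measure_empty] at h1
    exact zero_ne_one h1
  obtain ⟨ω₀⟩ := hΩ
  have hw : ∀ v, 0 ≤ w v := fun v => (norm_nonneg _).trans (hgw v ω₀)
  -- the weights `w' = w · e^{a}` satisfy the E′-COMB criterion for the cell incompatibility
  set w' : V → ℝ := fun u => w u * Real.exp (a u) with hw'
  have hw'0 : ∀ u, 0 ≤ w' u := fun u => mul_nonneg (hw u) (Real.exp_nonneg _)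
  have hcrit' : ∀ v ∈ C, ∑ u ∈ C with (u = v ∨ R u v), w' u * Real.exp (a u) ≤ a v := by
    intro v hv
    refine le_of_eq_of_le (Finset.sum_congr rfl fun u _ => ?_) (hcrit v hv)
    rw [hw', mul_assoc, ← Real.exp_add, two_mul]
  have hcomb := pinned_connected_sum_le (inc := fun x y => x = y ∨ R x y)
    (fun γ => Or.inl rfl) (fun γ γ' h => h.elim (fun e => Or.inl e.symm) fun r => Or.inr (hR _ _ r))
    (w := w') (a := a) hw'0 C hcrit'
  rw [rconnSubsets_eq_or] at hcomb
  -- the KP sum at a polymer `K`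
  intro K hK
  obtain ⟨hKC, hKconn⟩ := mem_rconnSubsets.1 hK
  set G := rconnSubsets R C with hG
  set T : Finset V → ℝ := kpTerm (connActivity R μ g) (fun K => ∑ v ∈ K, a v) with hT
  have hT0 : ∀ K' ∈ G, 0 ≤ T K' := fun K' _ => kpTerm_nonneg _ _ K'
  -- first covering: by the cell `v ∈ K` met by the incompatible polymer
  have hcov1 : ∑ K' ∈ G with GeomInc R K' K, T K' ≤
      ∑ v ∈ K, ∑ K' ∈ G with (∃ u ∈ K', u = v ∨ R u v), T K' := by
    refine sum_le_sum_sum_filter_of_cover _ G K (fun v K' => ∃ u ∈ K', u = v ∨ R u v) T hT0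
      (filter_subset _ _) fun K' hK' => ?_
    exact exists_mem_eq_or_rel_of_geomInc hKconn.1 (mem_filter.1 hK').2
  -- second covering, for fixed `v`: by the cell `u` itself
  have hcov2 : ∀ v ∈ K, ∑ K' ∈ G with (∃ u ∈ K', u = v ∨ R u v), T K' ≤
      ∑ u ∈ C with (u = v ∨ R u v), ∑ K' ∈ G with u ∈ K', T K' := by
    intro v _
    refine sum_le_sum_sum_filter_of_cover _ G (C.filter fun u => u = v ∨ R u v)
      (fun u K' => u ∈ K') T hT0 (filter_subset _ _) fun K' hK' => ?_
    obtain ⟨hK'G, u, huK', huv⟩ := mem_filter.1 hK'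
    exact ⟨u, mem_filter.2 ⟨(mem_rconnSubsets.1 hK'G).1 huK', huv⟩, huK'⟩
  -- the pinned sums by E′-COMB
  have hpin : ∀ u ∈ C, ∑ K' ∈ G with u ∈ K', T K' ≤ w u * Real.exp (2 * a u) := by
    intro u hu
    calc ∑ K' ∈ G with u ∈ K', T K'
        ≤ ∑ K' ∈ G with u ∈ K', ∏ u' ∈ K', w' u' :=
          sum_le_sum fun K' _ => kpTerm_connActivity_le hgw hw K'
      _ ≤ w' u * Real.exp (a u) := hcomb u hu
      _ = w u * Real.exp (2 * a u) := by rw [hw', mul_assoc, ← Real.exp_add, two_mul]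
  -- assemble
  calc ∑ K' ∈ G with GeomInc R K' K, T K'
      ≤ ∑ v ∈ K, ∑ K' ∈ G with (∃ u ∈ K', u = v ∨ R u v), T K' := hcov1
    _ ≤ ∑ v ∈ K, ∑ u ∈ C with (u = v ∨ R u v), ∑ K' ∈ G with u ∈ K', T K' :=
        sum_le_sum hcov2
    _ ≤ ∑ v ∈ K, ∑ u ∈ C with (u = v ∨ R u v), w u * Real.exp (2 * a u) :=
        sum_le_sum fun v _ => sum_le_sum fun u hu => hpin u (mem_filter.1 hu).1
    _ ≤ ∑ v ∈ K, a v := sum_le_sum fun v hv => hcrit v (hKC hv)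

/-- **`exp (log Z(C)) = Z(C)` FOR THE WEIGHTED ENGINE** — the usable output: under
`IsLocalPerturbation μ R 𝓕 g ε`, cell-dependent bounds `‖g v ω‖ ≤ w v` and the doubled-exponent
pinned criterion, the Kotecký–Preiss logarithm ✓`pertLogZ` of the perturbed partition function
exponentiates to ✓`pertZ` (weighted twin of ✓`exp_pertLogZ`; the cluster expansion
✓`pertLogZ_eq_sum_truncatedWeight` is unconditional).  Independence (`IsLocalPerturbation.indep`)
enters here, through ✓`pertZ_eq_polymerPartitionFunction`. [cite: KoteckyPreiss1986, §2] -/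
theorem exp_pertLogZ_weighted [IsProbabilityMeasure μ] [DecidableRel R]
    (hR : ∀ x y, R x y → R y x) (h : IsLocalPerturbation μ R 𝓕 g ε)
    (hgw : ∀ v ω, ‖g v ω‖ ≤ w v) (C : Finset V)
    (hcrit : ∀ v ∈ C, ∑ u ∈ C with (u = v ∨ R u v), w u * Real.exp (2 * a u) ≤ a v) :
    Complex.exp (pertLogZ μ g R C) = pertZ μ g C := by
  haveI : Std.Symm R := ⟨hR⟩
  rw [pertZ_eq_polymerPartitionFunction hR h C,
    ← polymerPartitionFunction_connActivity fun X hX => (mem_rconnSubsets.1 hX).2]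
  exact exp_polymerLogZ_of_kp (isKPVolume_connActivity_weighted hR hgw C hcrit) subset_rfl

/-! ## §4 The sketch's `Prop`, by text -/

/-- **`WeightedLocalPerturbationKP` of `Cruxes/FluctuationComparisonRegPrIntL/EPrimeSketch.lean`,
UNFOLDED TOKEN FOR TOKEN** (E′ of crux idea `neumann-frd-step`): a local perturbation of a
finite-range reference process whose factors obey cell-dependent bounds `‖g v ω‖ ≤ w v` and the
doubled-exponent pinned criterion has connected activities forming a KP volume on the polymers of
`C` with size function `K ↦ ∑_{v ∈ K} a v`.  A line importing this file closes the sketch's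
`WeightedLocalPerturbationKP` by `:= weightedLocalPerturbationKP`.  (The `IsLocalPerturbation` and
`0 ≤ a` binders are carried; the bound uses only `‖g v ω‖ ≤ w v`, `R` symmetric and the criterion.)
[cite: KoteckyPreiss1986, §2] [cite: BauerschmidtBrydgesSlade2019, §3.3] -/
theorem weightedLocalPerturbationKP :
    ∀ (V Ω : Type) [DecidableEq V] [MeasurableSpace Ω] (μ : Measure Ω) [IsProbabilityMeasure μ]
    (R : V → V → Prop) [DecidableRel R] (𝓕 : V → MeasurableSpace Ω) (g : V → Ω → ℂ) (ε : ℝ) (w a : V → ℝ)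
    (C : Finset V),
    (∀ x y, R x y → R y x) → IsLocalPerturbation μ R 𝓕 g ε → (∀ v ω, ‖g v ω‖ ≤ w v) → (∀ v, 0 ≤ a v) →
    (∀ v ∈ C, ∑ u ∈ C with (u = v ∨ R u v), w u * Real.exp (2 * a u) ≤ a v) →
    IsKPVolume (GeomInc R) (connActivity R μ g) (fun K => ∑ v ∈ K, a v) (rconnSubsets R C) := by
  intro V Ω _ _ μ _ R _ 𝓕 g ε w a C hR _ hgw _ hcrit
  exact isKPVolume_connActivity_weighted hR hgw C hcrit

end Summit.QuantumFields.YangMills.Theorems.FluctuationComparisonRegPrIntLS2BetaEPrimeWeightedKP
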